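import Summits.CriticalPhenomena.PercolationContinuityZ3.Theorems.PercNearOneGluingNoHeavyLowerTailSahiLatinZeroBottomTwoBlockKit

/-!
# `NoHeavyLowerTail` (crux stmt-CriticalPhenomena-4575), Sahi programme (prim-master-conj gen 52): THE TWO-BLOCK CERTIFICATE (abstract part) —
# configurations of a pair of Latin triples, the `Ψ`-integrand, the machine-found conditional-Harris certificate as a key lookup, the
# 36-fold symmetrisation and its invariance, and the reduction of the finite check to a fundamental domain

Support file (`--supports stmt-CriticalPhenomena-4575`; computable definitions + proofs, kernel only (`decide`), no `sorry`, standard axioms).  Memo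
`run/shared/lean/prim/prim-l12/FROM-prim-master-conj-g52-ONE-BLOCK.md` §4–§5.  Nothing here asserts the crux, Kahn's conjecture or (C¼); the companion files
`…TwoBlockCertChk*` perform the finite check and `…ZeroBottomTwoBlock` instantiates everything on the grid.

THE MATHEMATICS.  A CONFIGURATION records, for a pair (Latin triple of `[3]^U`, Latin triple of `[3]^V`), the types `u i ∈ {0,1,2}` of the three `U`-points
w.r.t. `S ⊆ S′` (`2` = in `S`, `1` = in `S′∖S`, `0` = outside), the types `v j` of the three `V`-points w.r.t. `R ⊆ R′`, and the bits `f i j` = [mixed point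
`(x_U^i, x_V^j) ∈ F`] (admissible: `f i j` whenever `u i = 2` or `v j = 2`).  `psiA` = the integrand of `Ψ` at the three diagonal points.  A conditional-Harris term
inside the `U`-block is `[key] · ([x_U ∈ S′][x_U ∈ L] − [x_U ∈ S′][y_U ∈ L])` with `L` a union of co-fibres of `F` (possibly cut by `S′`) and `key` = the conditioning data
(type of the third `U`-point, its three `F`-bits, the three `V`-types; encoded as a number `< 648`); the certificate (68 terms, multipliers `1,2,3`; HOME/code-g52) is stored as
the key lookups `assocU`, `assocV` plus two joint terms.  `phi36` = the symmetrisation of `psiA − cert` over the `36` re-indexings; `phi36_act` (invariance) reduces the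
check `phi36 ≥ 0` to configurations with SORTED type triples (`phi36_nonneg_of_sorted`), which the `…Chk*` files verify by `decide`. [this work]
-/

namespace Summit.CriticalPhenomena.PercolationContinuityZ3.Theorems.SahiLatin.TwoBlock

open Summit.CriticalPhenomena.PercolationContinuityZ3.Theorems.SahiLatin (perms3E)

/-- `Bool ↦ {0,1}`. [this work] -/
def bi (b : Bool) : ℤ := if b then 1 else 0

/-- `Bool ↦ {0,1} ⊆ ℕ`. [this work] -/
def bn (b : Bool) : ℕ := if b then 1 else 0

/-- Configurations: `U`-types, `V`-types, `F`-bits of the nine mixed points. [this work] -/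
abbrev Cfg := (Fin 3 → Fin 3) × (Fin 3 → Fin 3) × (Fin 3 → Fin 3 → Bool)

/-- Re-indexing the `U`-points by `σ` and the `V`-points by `τ`. [this work] -/
def act (c : Cfg) (σ τ : Fin 3 → Fin 3) : Cfg := (c.1 ∘ σ, c.2.1 ∘ τ, fun i j => c.2.2 (σ i) (τ j))

/-- Swapping the roles of the two blocks. [this work] -/
def tr (c : Cfg) : Cfg := (c.2.1, c.1, fun i j => c.2.2 j i)

/-- Admissibility: `F ⊇ S × Ω ∪ Ω × R`. [this work] -/
def adm (c : Cfg) : Bool := decide (∀ i j : Fin 3, (c.1 i = 2 → c.2.2 i j = true) ∧ (c.2.1 j = 2 → c.2.2 i j = true))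

/-- `[U-point i ∈ S]`. [this work] -/
def isS (c : Cfg) (i : Fin 3) : ℤ := if c.1 i = 2 then 1 else 0
/-- `[U-point i ∈ S′ ∖ S]`. [this work] -/
def isB (c : Cfg) (i : Fin 3) : ℤ := if c.1 i = 1 then 1 else 0
/-- `[U-point i ∈ S′]`. [this work] -/
def isSp (c : Cfg) (i : Fin 3) : ℤ := if c.1 i = 0 then 0 else 1
/-- `[V-point j ∈ R]`. [this work] -/
def isR (c : Cfg) (j : Fin 3) : ℤ := if c.2.1 j = 2 then 1 else 0
/-- `[V-point j ∈ R′ ∖ R]`. [this work] -/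
def isC (c : Cfg) (j : Fin 3) : ℤ := if c.2.1 j = 1 then 1 else 0
/-- `[V-point j ∈ R′]`. [this work] -/
def isRp (c : Cfg) (j : Fin 3) : ℤ := if c.2.1 j = 0 then 0 else 1
/-- `[mixed point (i,j) ∈ F]`. [this work] -/
def fF (c : Cfg) (i j : Fin 3) : ℤ := bi (c.2.2 i j)

/-- The `Ψ`-integrand at the diagonal points `(k,k)`, `k = 0,1,2` (`x, y, z`). [this work] -/
def psiA (c : Cfg) : ℤ :=
  2 * (fF c 0 0 * isR c 0 * isB c 0) + 2 * (fF c 0 0 * isS c 0 * isC c 0) + 2 * (fF c 0 0 * isB c 0 * isC c 0)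
    - fF c 0 0 * isS c 0 * isC c 1 - fF c 0 0 * isB c 0 * isR c 1 + 3 * (fF c 0 0 * isB c 0 * isC c 1)
    - fF c 0 0 * isR c 0 * isB c 1 - fF c 0 0 * isC c 0 * isS c 1 + 3 * (fF c 0 0 * isC c 0 * isB c 1)
    + fF c 0 0 * isS c 1 * isC c 2 + fF c 0 0 * isB c 1 * isR c 2 - 3 * (fF c 0 0 * isB c 1 * isC c 2)
    - fF c 0 0 * (isR c 1 * isB c 1) - fF c 0 0 * (isS c 1 * isC c 1) - fF c 0 0 * (isB c 1 * isC c 1)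

/-- Specification of `L = F_j`, `F_j ∪ F_k` or `F_j ∪ (S′ ∩ F_k)` (`F_j` = co-fibre of `F` at the `j`-th point of the other block). [this work] -/
structure LSpec where
  /-- first co-fibre index -/
  j : Fin 3
  /-- optional second co-fibre index -/
  k : Option (Fin 3)
  /-- intersect the second co-fibre with `S′`? -/
  cap : Bool
  deriving DecidableEq

/-- `[U-point i ∈ L]`. [this work] -/
def memL (c : Cfg) (L : LSpec) (i : Fin 3) : ℤ :=
  bi (c.2.2 i L.j || (match L.k with
    | none => false
    | some k => (if L.cap then !decide (c.1 i = 0) else true) && c.2.2 i k))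

/-- The bracket of a `U`-term: `[x_U ∈ S′][x_U ∈ L] − [x_U ∈ S′][y_U ∈ L]`. [this work] -/
def brU (c : Cfg) (L : LSpec) : ℤ := isSp c 0 * memL c L 0 - isSp c 0 * memL c L 1

/-- The conditioning key of a configuration: type of the third `U`-point, its `F`-row, the three `V`-types (a number `< 648`). [this work] -/
def keyU (c : Cfg) : ℕ :=
  (c.1 2).val + 3 * (bn (c.2.2 2 0) + 2 * bn (c.2.2 2 1) + 4 * bn (c.2.2 2 2)) + 24 * ((c.2.1 0).val + 3 * (c.2.1 1).val + 9 * (c.2.1 2).val)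

/-- The `U`-half of the certificate as a flat list `(key, multiplier, L)` (33 terms). [this work] -/
def termsU : List (ℕ × ℤ × LSpec) :=
  [(216, 1, ⟨0, (some 1), false⟩),
    (222, 2, ⟨1, (some 2), false⟩),
    (222, 1, ⟨0, (some 1), false⟩),
    (222, 1, ⟨0, none, false⟩),
    (234, 1, ⟨1, (some 2), false⟩),
    (225, 1, ⟨0, (some 2), false⟩),
    (225, 1, ⟨1, none, false⟩),
    (237, 1, ⟨0, (some 2), false⟩),
    (288, 1, ⟨0, (some 2), false⟩),
    (288, 1, ⟨0, (some 2), true⟩),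
    (291, 3, ⟨0, (some 2), false⟩),
    (291, 1, ⟨1, (some 2), false⟩),
    (303, 1, ⟨0, (some 2), false⟩),
    (303, 1, ⟨0, (some 2), true⟩),
    (303, 2, ⟨2, (some 1), true⟩),
    (303, 1, ⟨0, (some 1), false⟩),
    (309, 1, ⟨0, (some 2), false⟩),
    (516, 1, ⟨0, (some 1), true⟩),
    (519, 2, ⟨0, (some 1), true⟩),
    (312, 1, ⟨0, (some 2), true⟩),
    (324, 1, ⟨0, (some 2), true⟩),
    (324, 1, ⟨2, (some 0), true⟩),
    (330, 1, ⟨2, (some 0), true⟩),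
    (217, 1, ⟨0, (some 1), false⟩),
    (223, 1, ⟨0, (some 2), true⟩),
    (223, 2, ⟨1, (some 2), true⟩),
    (226, 1, ⟨0, (some 2), true⟩),
    (289, 2, ⟨0, (some 2), true⟩),
    (292, 2, ⟨0, (some 2), true⟩),
    (313, 1, ⟨0, (some 2), true⟩),
    (239, 1, ⟨0, (some 2), false⟩),
    (311, 2, ⟨0, (some 2), false⟩),
    (335, 1, ⟨0, (some 2), true⟩)]

/-- The `V`-half of the certificate (33 terms; keys and brackets evaluated on the transposed configuration). [this work] -/
def termsV : List (ℕ × ℤ × LSpec) :=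
  [(216, 1, ⟨0, (some 1), false⟩),
    (222, 2, ⟨1, (some 2), false⟩),
    (234, 1, ⟨1, (some 2), false⟩),
    (222, 1, ⟨0, (some 1), false⟩),
    (222, 1, ⟨0, none, false⟩),
    (225, 1, ⟨0, (some 2), false⟩),
    (237, 1, ⟨0, (some 2), false⟩),
    (225, 1, ⟨1, none, false⟩),
    (217, 1, ⟨0, (some 1), false⟩),
    (223, 1, ⟨0, (some 2), true⟩),
    (223, 2, ⟨1, (some 2), true⟩),
    (226, 1, ⟨0, (some 2), true⟩),
    (239, 1, ⟨0, (some 2), false⟩),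
    (288, 1, ⟨0, (some 2), false⟩),
    (288, 1, ⟨0, (some 2), true⟩),
    (291, 3, ⟨0, (some 2), false⟩),
    (291, 1, ⟨1, (some 2), false⟩),
    (303, 1, ⟨0, (some 2), false⟩),
    (303, 1, ⟨0, (some 2), true⟩),
    (303, 2, ⟨2, (some 0), true⟩),
    (303, 1, ⟨0, (some 1), false⟩),
    (309, 1, ⟨0, (some 2), false⟩),
    (289, 2, ⟨0, (some 2), true⟩),
    (292, 2, ⟨0, (some 2), true⟩),
    (311, 2, ⟨0, (some 2), false⟩),
    (516, 1, ⟨0, (some 1), true⟩),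
    (519, 2, ⟨0, (some 1), true⟩),
    (312, 1, ⟨0, (some 2), true⟩),
    (324, 1, ⟨0, (some 2), true⟩),
    (324, 1, ⟨2, (some 0), true⟩),
    (330, 1, ⟨1, (some 2), true⟩),
    (313, 1, ⟨0, (some 2), true⟩),
    (335, 1, ⟨0, (some 2), true⟩)]

/-- Fast lookup of the `U`-terms by key. [this work] -/
def assocU : ℕ → List (ℤ × LSpec)
  | 216 => [(1, ⟨0, (some 1), false⟩)]
  | 217 => [(1, ⟨0, (some 1), false⟩)]
  | 222 => [(2, ⟨1, (some 2), false⟩), (1, ⟨0, (some 1), false⟩), (1, ⟨0, none, false⟩)]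
  | 223 => [(1, ⟨0, (some 2), true⟩), (2, ⟨1, (some 2), true⟩)]
  | 225 => [(1, ⟨0, (some 2), false⟩), (1, ⟨1, none, false⟩)]
  | 226 => [(1, ⟨0, (some 2), true⟩)]
  | 234 => [(1, ⟨1, (some 2), false⟩)]
  | 237 => [(1, ⟨0, (some 2), false⟩)]
  | 239 => [(1, ⟨0, (some 2), false⟩)]
  | 288 => [(1, ⟨0, (some 2), false⟩), (1, ⟨0, (some 2), true⟩)]
  | 289 => [(2, ⟨0, (some 2), true⟩)]
  | 291 => [(3, ⟨0, (some 2), false⟩), (1, ⟨1, (some 2), false⟩)]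
  | 292 => [(2, ⟨0, (some 2), true⟩)]
  | 303 => [(1, ⟨0, (some 2), false⟩), (1, ⟨0, (some 2), true⟩), (2, ⟨2, (some 1), true⟩), (1, ⟨0, (some 1), false⟩)]
  | 309 => [(1, ⟨0, (some 2), false⟩)]
  | 311 => [(2, ⟨0, (some 2), false⟩)]
  | 312 => [(1, ⟨0, (some 2), true⟩)]
  | 313 => [(1, ⟨0, (some 2), true⟩)]
  | 324 => [(1, ⟨0, (some 2), true⟩), (1, ⟨2, (some 0), true⟩)]
  | 330 => [(1, ⟨2, (some 0), true⟩)]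
  | 335 => [(1, ⟨0, (some 2), true⟩)]
  | 516 => [(1, ⟨0, (some 1), true⟩)]
  | 519 => [(2, ⟨0, (some 1), true⟩)]
  | _ => []

/-- Fast lookup of the `V`-terms by key. [this work] -/
def assocV : ℕ → List (ℤ × LSpec)
  | 216 => [(1, ⟨0, (some 1), false⟩)]
  | 217 => [(1, ⟨0, (some 1), false⟩)]
  | 222 => [(2, ⟨1, (some 2), false⟩), (1, ⟨0, (some 1), false⟩), (1, ⟨0, none, false⟩)]
  | 223 => [(1, ⟨0, (some 2), true⟩), (2, ⟨1, (some 2), true⟩)]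
  | 225 => [(1, ⟨0, (some 2), false⟩), (1, ⟨1, none, false⟩)]
  | 226 => [(1, ⟨0, (some 2), true⟩)]
  | 234 => [(1, ⟨1, (some 2), false⟩)]
  | 237 => [(1, ⟨0, (some 2), false⟩)]
  | 239 => [(1, ⟨0, (some 2), false⟩)]
  | 288 => [(1, ⟨0, (some 2), false⟩), (1, ⟨0, (some 2), true⟩)]
  | 289 => [(2, ⟨0, (some 2), true⟩)]
  | 291 => [(3, ⟨0, (some 2), false⟩), (1, ⟨1, (some 2), false⟩)]
  | 292 => [(2, ⟨0, (some 2), true⟩)]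
  | 303 => [(1, ⟨0, (some 2), false⟩), (1, ⟨0, (some 2), true⟩), (2, ⟨2, (some 0), true⟩), (1, ⟨0, (some 1), false⟩)]
  | 309 => [(1, ⟨0, (some 2), false⟩)]
  | 311 => [(2, ⟨0, (some 2), false⟩)]
  | 312 => [(1, ⟨0, (some 2), true⟩)]
  | 313 => [(1, ⟨0, (some 2), true⟩)]
  | 324 => [(1, ⟨0, (some 2), true⟩), (1, ⟨2, (some 0), true⟩)]
  | 330 => [(1, ⟨1, (some 2), true⟩)]
  | 335 => [(1, ⟨0, (some 2), true⟩)]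
  | 516 => [(1, ⟨0, (some 1), true⟩)]
  | 519 => [(2, ⟨0, (some 1), true⟩)]
  | _ => []

/-- The `U`-certificate value (lookup form). [this work] -/
def certUf (c : Cfg) : ℤ := ((assocU (keyU c)).map fun p => p.1 * brU c p.2).sum

/-- The `V`-certificate value (lookup form, on the transposed configuration). [this work] -/
def certVf (c : Cfg) : ℤ := ((assocV (keyU (tr c))).map fun p => p.1 * brU (tr c) p.2).sum

/-- Joint term: `[z ∈ (S′∖S)×(Ω∖R′) ∩ F]·([x ∈ Ω×R′][x ∈ F ∩ S′×Ω] − [x ∈ Ω×R′][y ∈ F ∩ S′×Ω])`. [this work] -/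
def termX1 (c : Cfg) : ℤ :=
  (if c.1 2 = 1 ∧ c.2.1 2 = 0 ∧ c.2.2 2 2 = true then 1 else 0) * (isRp c 0 * (fF c 0 0 * isSp c 0) - isRp c 0 * (fF c 1 1 * isSp c 1))

/-- Joint term, mirror image. [this work] -/
def termX2 (c : Cfg) : ℤ :=
  (if c.1 2 = 0 ∧ c.2.1 2 = 1 ∧ c.2.2 2 2 = true then 1 else 0) * (isSp c 0 * (fF c 0 0 * isRp c 0) - isSp c 0 * (fF c 1 1 * isRp c 1))

/-- Target minus certificate (lookup form). [this work] -/
def phi (c : Cfg) : ℤ := psiA c - (certUf c + certVf c + termX1 c + termX2 c)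

/-- The 36-fold symmetrisation of `phi` over the explicit list `perms3E`. [this work] -/
def phi36 (c : Cfg) : ℤ :=
  (perms3E.map fun (σ : Equiv.Perm (Fin 3)) => (perms3E.map fun (τ : Equiv.Perm (Fin 3)) => phi (act c σ τ)).sum).sum

/-- The six permutations as plain functions (cheap to evaluate). [this work] -/
def perms3F : List (Fin 3 → Fin 3) := [![0, 1, 2], ![1, 0, 2], ![2, 1, 0], ![0, 2, 1], ![2, 0, 1], ![1, 2, 0]]

/-- `perms3F` are the coercions of `perms3E` (finite check). [this work] -/
theorem perms3F_eq : perms3F = perms3E.map (fun σ : Equiv.Perm (Fin 3) => (σ : Fin 3 → Fin 3)) := by decide +kernel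

/-- Fast form of `phi36` (plain functions). [this work] -/
def phi36F (c : Cfg) : ℤ := (perms3F.map fun σ => (perms3F.map fun τ => phi (act c σ τ)).sum).sum

/-- `phi36F = phi36`. [this work] -/
theorem phi36F_eq (c : Cfg) : phi36F c = phi36 c := by
  unfold phi36F phi36; rw [perms3F_eq]; simp only [List.map_map, Function.comp_def]

/-! ## The lookup form equals the weighted form (bridge used by the grid file) -/

/-- The `U`-certificate value in weighted form: `Σ_t λ_t [keyU c = key_t] br_t`. [this work] -/
def certUw (c : Cfg) : ℤ := (termsU.map fun t => t.2.1 * ((if keyU c = t.1 then 1 else 0) * brU c t.2.2)).sum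

/-- The `V`-certificate value in weighted form. [this work] -/
def certVw (c : Cfg) : ℤ := (termsV.map fun t => t.2.1 * ((if keyU (tr c) = t.1 then 1 else 0) * brU (tr c) t.2.2)).sum

/-- Keys are `< 648`. [this work] -/
theorem keyU_lt (c : Cfg) : keyU c < 648 := by
  unfold keyU bn
  have h1 := (c.1 2).isLt; have h2 := (c.2.1 0).isLt; have h3 := (c.2.1 1).isLt; have h4 := (c.2.1 2).isLt
  split_ifs <;> omega

/-- The lookup table is the key-grouping of `termsU` (finite check). [this work] -/
theorem assocU_eq : ∀ k : Fin 648, assocU k.val = (termsU.filter fun t => t.1 = k.val).map (fun t => t.2) := by decide +kernel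

/-- The lookup table is the key-grouping of `termsV` (finite check). [this work] -/
theorem assocV_eq : ∀ k : Fin 648, assocV k.val = (termsV.filter fun t => t.1 = k.val).map (fun t => t.2) := by decide +kernel

/-- A filtered sum is a sum with indicator weights. [this work] -/
theorem sum_map_filter_key (l : List (ℕ × ℤ × LSpec)) (k : ℕ) (g : LSpec → ℤ) :
    ((l.filter fun t => t.1 = k).map (fun t => t.2.1 * g t.2.2)).sum =
      (l.map fun t => t.2.1 * ((if k = t.1 then 1 else 0) * g t.2.2)).sum := by
  induction l with
  | nil => simp
  | cons a l ih =>
    by_cases h : a.1 = k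
    · subst h; simp [ih]
    · have h' : ¬ k = a.1 := fun e => h e.symm
      simp [h, h', ih]

/-- Lookup form = weighted form (`U`). [this work] -/
theorem certUf_eq (c : Cfg) : certUf c = certUw c := by
  unfold certUf certUw
  rw [show keyU c = (⟨keyU c, keyU_lt c⟩ : Fin 648).val from rfl, assocU_eq, List.map_map]
  exact sum_map_filter_key termsU _ (brU c)

/-- Lookup form = weighted form (`V`). [this work] -/
theorem certVf_eq (c : Cfg) : certVf c = certVw c := by
  unfold certVf certVw
  rw [show keyU (tr c) = (⟨keyU (tr c), keyU_lt (tr c)⟩ : Fin 648).val from rfl, assocV_eq, List.map_map]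
  exact sum_map_filter_key termsV _ (brU (tr c))

/-- The multipliers are nonnegative (finite check). [this work] -/
theorem termsU_nonneg : ∀ t ∈ termsU, 0 ≤ t.2.1 := by decide +kernel

/-- The multipliers are nonnegative (finite check). [this work] -/
theorem termsV_nonneg : ∀ t ∈ termsV, 0 ≤ t.2.1 := by decide +kernel

/-! ## Invariance of `phi36` under re-indexing; reduction to sorted type triples -/

/-- `act` composes. [this work] -/
theorem act_act (c : Cfg) (σ τ σ' τ' : Equiv.Perm (Fin 3)) : act (act c σ τ) σ' τ' = act c (⇑(σ * σ')) (⇑(τ * τ')) := rfl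

/-- Left multiplication permutes `perms3E` (finite check). [this work] -/
theorem perms3E_mul_perm : ∀ σ ∈ perms3E, (perms3E.map (σ * ·)).Perm perms3E := by decide +kernel

/-- **Invariance**: `phi36 (act c σ τ) = phi36 c` for `σ, τ ∈ perms3E`. [this work] -/
theorem phi36_act (c : Cfg) {σ τ : Equiv.Perm (Fin 3)} (hσ : σ ∈ perms3E) (hτ : τ ∈ perms3E) : phi36 (act c σ τ) = phi36 c := by
  unfold phi36
  simp only [act_act]
  have inner : ∀ σ' : Equiv.Perm (Fin 3), (perms3E.map fun (τ' : Equiv.Perm (Fin 3)) => phi (act c (⇑(σ * σ')) (⇑(τ * τ')))).sum =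
      (perms3E.map fun (τ' : Equiv.Perm (Fin 3)) => phi (act c (⇑(σ * σ')) τ')).sum := by
    intro σ'
    have := ((perms3E_mul_perm τ hτ).map (fun (τ'' : Equiv.Perm (Fin 3)) => phi (act c (⇑(σ * σ')) τ''))).sum_eq
    rw [List.map_map] at this; exact this
  simp only [inner]
  have := ((perms3E_mul_perm σ hσ).map (fun (σ'' : Equiv.Perm (Fin 3)) => (perms3E.map fun (τ' : Equiv.Perm (Fin 3)) => phi (act c σ'' τ')).sum)).sum_eq
  rw [List.map_map] at this; exact this

/-- Admissibility is invariant under re-indexing by permutations. [this work] -/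
theorem adm_act (c : Cfg) (σ τ : Equiv.Perm (Fin 3)) (h : adm c = true) : adm (act c σ τ) = true := by
  unfold adm at h ⊢; rw [decide_eq_true_eq] at h ⊢
  intro i j; exact h (σ i) (τ j)

/-- The ten sorted type triples. [this work] -/
def sorted3 : Fin 10 → (Fin 3 → Fin 3) := ![![0, 0, 0], ![0, 0, 1], ![0, 0, 2], ![0, 1, 1], ![0, 1, 2], ![0, 2, 2], ![1, 1, 1], ![1, 1, 2], ![1, 2, 2], ![2, 2, 2]]

/-- Every type triple is sorted by some permutation in `perms3E` (finite check). [this work] -/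
theorem exists_sort3 : ∀ u : Fin 3 → Fin 3, ∃ σ ∈ perms3E, ∃ k : Fin 10, u ∘ σ = sorted3 k := by decide +kernel

/-- Decode `m < 512` to a bit matrix. [this work] -/
def dec512 (m : Fin 512) : Fin 3 → Fin 3 → Bool := fun i j => Nat.testBit m.val (3 * i.val + j.val)

/-- Encode a bit matrix. [this work] -/
def enc512 (f : Fin 3 → Fin 3 → Bool) : Fin 512 :=
  ⟨bn (f 0 0) + 2 * bn (f 0 1) + 4 * bn (f 0 2) + 8 * bn (f 1 0) + 16 * bn (f 1 1) + 32 * bn (f 1 2) + 64 * bn (f 2 0) + 128 * bn (f 2 1) + 256 * bn (f 2 2),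
   by unfold bn; split_ifs <;> decide⟩

/-- Row decoding helper: the eight rows. [this work] -/
theorem dec512_enc512_aux : ∀ r₀ r₁ r₂ : Fin 8,
    dec512 ⟨r₀.val + 8 * r₁.val + 64 * r₂.val, by omega⟩ = fun i => ![fun j => Nat.testBit r₀.val j.val, fun j => Nat.testBit r₁.val j.val,
      fun j => Nat.testBit r₂.val j.val] i := by decide +kernel

/-- `dec512 ∘ enc512 = id`. [this work] -/
theorem dec512_enc512 (f : Fin 3 → Fin 3 → Bool) : dec512 (enc512 f) = f := by
  have hrow : ∀ h : Fin 3 → Bool, (fun j : Fin 3 => Nat.testBit (bn (h 0) + 2 * bn (h 1) + 4 * bn (h 2)) j.val) = h := by decide +kernel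
  have e : enc512 f = ⟨(bn (f 0 0) + 2 * bn (f 0 1) + 4 * bn (f 0 2)) + 8 * (bn (f 1 0) + 2 * bn (f 1 1) + 4 * bn (f 1 2))
      + 64 * (bn (f 2 0) + 2 * bn (f 2 1) + 4 * bn (f 2 2)), by unfold bn; split_ifs <;> decide⟩ := by
    apply Fin.ext; simp [enc512]; ring
  have b0 : bn (f 0 0) + 2 * bn (f 0 1) + 4 * bn (f 0 2) < 8 := by unfold bn; split_ifs <;> decide
  have b1 : bn (f 1 0) + 2 * bn (f 1 1) + 4 * bn (f 1 2) < 8 := by unfold bn; split_ifs <;> decide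
  have b2 : bn (f 2 0) + 2 * bn (f 2 1) + 4 * bn (f 2 2) < 8 := by unfold bn; split_ifs <;> decide
  rw [e]
  have := dec512_enc512_aux ⟨_, b0⟩ ⟨_, b1⟩ ⟨_, b2⟩
  rw [this]
  funext i j
  fin_cases i <;> simp [hrow]

/-- The sorted configuration with codes `(a, b, m)`. [this work] -/
def srtCfg (a b : Fin 10) (m : Fin 512) : Cfg := (sorted3 a, sorted3 b, dec512 m)

/-- **Reduction to the fundamental domain**: if `phi36 ≥ 0` on all admissible SORTED configurations then on all admissible configurations. [this work] -/
theorem phi36_nonneg_of_sorted (H : ∀ a b : Fin 10, ∀ m : Fin 512, adm (srtCfg a b m) = true → 0 ≤ phi36F (srtCfg a b m))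
    (c : Cfg) (hc : adm c = true) : 0 ≤ phi36 c := by
  obtain ⟨u, v, f⟩ := c
  obtain ⟨σ, hσ, a, ha⟩ := exists_sort3 u
  obtain ⟨τ, hτ, b, hb⟩ := exists_sort3 v
  rw [← phi36_act (u, v, f) hσ hτ]
  have e : act (u, v, f) σ τ = srtCfg a b (enc512 fun i j => f (σ i) (τ j)) := by
    unfold act srtCfg; rw [dec512_enc512]; exact Prod.ext ha (Prod.ext hb rfl)
  rw [e, ← phi36F_eq]
  exact H a b _ (by rw [← e]; exact adm_act _ σ τ hc)

end Summit.CriticalPhenomena.PercolationContinuityZ3.Theorems.SahiLatin.TwoBlock
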